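import Literature.Geometry.DiscreteGeometry.LayerStackings
import Literature.Geometry.DiscreteGeometry.LayerShellPatterns
import Summits.AtomisticToContinuum.Crystallization.Theorems.ChessboardParticlePlanesPeriodicWindowsHexClosure
import Summits.AtomisticToContinuum.Crystallization.Theorems.ChessboardParticlePlanesPeriodicWindowsBarlowOfLevels

/-!
# Crux `StackingFaultSparsity` (stmt-AtomisticToContinuum-14296), line `Sketch` — stub
# `stub_barlowOfOneLength` (S12), helper A: the scaled closed unit shell of a one-length local
# frame is a twelve-point configuration through a hexagon, hence an FCC or HCP pattern

Helper file of the stub `stub_barlowOfOneLength` (one-length exact local frames ⇒ an isometric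
Barlow stacking), in Hales's normalisation (touching centres at distance `2`, frame
`u₁ = (2,0,0)`, `u₂ = (1,√3,0)` of `LayerShells.lean`).

* `exists_frame_of_planar_hexagon` (the planar step): six horizontal points (`y 2 = 0`) of norm
  `2` with pairwise distances `≥ 2` are a rotated standard hexagon — there is a linear isometry
  of `ℝ³` mapping `hexagonSet = {±u₁, ±u₂, ±(u₁ − u₂)}` into them.  In the planar complex
  coordinate `ζ y = (y 0 + i y 1)/2` the six points are unit complex numbers pairwise at distance
  `≥ 1`; by the sextant lemma `hexVertex_mul_mem` (`…PeriodicWindowsHexClosure`) the set is closed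
  under multiplication by `ω = e^{iπ/3}`, so with `y₁ ∈ F` and `v₁ ∈ F` the point over
  `ζ y₁ · ω`, the six points are `±y₁, ±v₁, ±(y₁ − v₁)` (`ω² = ω − 1`), `⟪y₁, v₁⟫ = 2`, and the
  frame isometry `exists_linearIsometry_frame` (`…PeriodicWindowsBarlowOfLevels`) with
  `u₁ ↦ y₁`, `u₂ ↦ v₁` does it.
* `isTwelveConfig_preimage`: twelve-point configurations (`IsTwelveConfig`) are preserved by
  linear isometries.
* `isArrangedIn_of_isTwelveConfig_of_hexagon` (registered helper statement): if `T ⊂ S²(2)` is a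
  twelve-point configuration (pairwise distances `≥ 2`) containing six points orthogonal to a
  unit vector `n`, then `T` is arranged in the FCC or in the HCP pattern.  Rotate `n` to `e₃`
  (an orthonormal basis with third vector `n`), move the six horizontal points onto the standard
  hexagon, apply Hales's "one hexagonal layer forces the next" `IsTwelveConfig.eq_layerShell`
  (*Dense Sphere Packings* §1.3, in the tree) to get `layerShell σ σ'`, which is the FCC pattern
  (`σ' = −σ`, `isArrangedIn_layerShell_fcc'`) or the HCP pattern (`σ' = σ`,
  `isArrangedIn_layerShell_hcp'`), and move back (`IsArrangedIn.preimage`).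
* `shell_isTwelveConfig`: for a point `p` of `X ⊂ ℝ³` carrying an exact one-length local frame
  (closed unit shell = hexagon `H` + triples `U`, `D`, all at distance `d ∈ (0, 1]` from `p`, at
  heights `0`, `c 1 > 0`, `c (−1) < 0` along `n`; strict-radius sharpness at the shell points),
  the recentred shell scaled by `2/d`, `{y | p + (d/2) y ∈ X, ‖y‖ = 2}`, is a twelve-point
  configuration containing the six scaled hexagon points, which are orthogonal to `n`.
All `[folklore]` given the cited inputs in the tree.
-/

noncomputable section

namespace Summit.AtomisticToContinuum.Crystallization.Theorems.SquareWellLayerCake.StackingFaultSparsity.LocalFrames.OneLength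

open Literature.Geometry.DiscreteGeometry Literature.MathematicalPhysics.StatisticalMechanics
open Summit.AtomisticToContinuum.Crystallization.Theorems.PeriodicWindowsSketch

/-- Horizontal distances in the planar complex coordinate `ζ y = (y 0 + i y 1)/2`:
`dist y y' = 2 ‖ζ y − ζ y'‖`. [folklore] -/
theorem dist_eq_two_mul_norm_zeta_sub (y y' : EuclideanSpace ℝ (Fin 3)) (hy : y 2 = 0)
    (hy' : y' 2 = 0) :
    dist y y' = 2 * ‖((⟨y 0 / 2, y 1 / 2⟩ : ℂ) - ⟨y' 0 / 2, y' 1 / 2⟩)‖ := by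
  rw [← sq_eq_sq₀ dist_nonneg (by positivity), mul_pow, Complex.sq_norm, Complex.normSq_apply,
    Complex.sub_re, Complex.sub_im, dist_sq_fin3, hy, hy', sub_self]
  ring

/-- A horizontal point of `S²(2)` has a unit planar coordinate. [folklore] -/
theorem norm_zeta_eq_one (y : EuclideanSpace ℝ (Fin 3)) (hy : y 2 = 0) (hn : ‖y‖ = 2) :
    ‖((⟨y 0 / 2, y 1 / 2⟩ : ℂ))‖ = 1 := by
  have h4 : y 0 ^ 2 + y 1 ^ 2 = 4 := by
    have h := norm_sq_fin3 y
    rw [hn, hy] at h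
    nlinarith
  rw [← sq_eq_sq₀ (norm_nonneg _) zero_le_one, Complex.sq_norm, Complex.normSq_apply]
  simp only [one_pow]
  nlinarith

/-- `ω = e^{iπ/3} = 1/2 + i√3/2` satisfies `ω² = ω − 1`. [folklore] -/
theorem omega_mul_omega :
    (⟨1 / 2, Real.sqrt 3 / 2⟩ : ℂ) * ⟨1 / 2, Real.sqrt 3 / 2⟩ = ⟨1 / 2, Real.sqrt 3 / 2⟩ - 1 := by
  have h3 : Real.sqrt 3 ^ 2 = 3 := Real.sq_sqrt (by norm_num)
  apply Complex.ext
  · simp only [Complex.mul_re, Complex.sub_re, Complex.one_re]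
    nlinarith
  · simp only [Complex.mul_im, Complex.sub_im, Complex.one_im]
    ring

/-- **Six horizontal points of `S²(2)` pairwise `≥ 2` apart are a rotated standard hexagon**: there
is a linear isometry of `ℝ³` mapping `hexagonSet` into them. [folklore] -/
theorem exists_frame_of_planar_hexagon (F : Finset (EuclideanSpace ℝ (Fin 3))) (hF6 : F.card = 6)
    (hF : ∀ y ∈ F, y 2 = 0 ∧ ‖y‖ = 2) (hsep : ∀ y ∈ F, ∀ y' ∈ F, y ≠ y' → 2 ≤ dist y y') :
    ∃ L : EuclideanSpace ℝ (Fin 3) ≃ₗᵢ[ℝ] EuclideanSpace ℝ (Fin 3),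
      ∀ x ∈ hexagonSet, L x ∈ (F : Set (EuclideanSpace ℝ (Fin 3))) := by
  -- the planar complex coordinate
  set ζ : EuclideanSpace ℝ (Fin 3) → ℂ := fun y => ⟨y 0 / 2, y 1 / 2⟩ with hζ
  have hdist : ∀ y y' : EuclideanSpace ℝ (Fin 3), y 2 = 0 → y' 2 = 0 →
      dist y y' = 2 * ‖ζ y - ζ y'‖ := fun y y' hy hy' => dist_eq_two_mul_norm_zeta_sub y y' hy hy'
  have hT1 : ∀ z ∈ F.image ζ, ‖z‖ = 1 := by
    intro z hz
    obtain ⟨y, hy, rfl⟩ := Finset.mem_image.1 hz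
    exact norm_zeta_eq_one y (hF y hy).1 (hF y hy).2
  have hT2 : ∀ z ∈ F.image ζ, ∀ w ∈ F.image ζ, z ≠ w → 1 ≤ ‖z - w‖ := by
    intro z hz w hw hzw
    obtain ⟨y, hy, rfl⟩ := Finset.mem_image.1 hz
    obtain ⟨y', hy', rfl⟩ := Finset.mem_image.1 hw
    have hne : y ≠ y' := fun h => hzw (by rw [h])
    have h := hsep y hy y' hy' hne
    rw [hdist y y' (hF y hy).1 (hF y' hy').1] at h
    linarith
  have hinj : Set.InjOn ζ (F : Set (EuclideanSpace ℝ (Fin 3))) := by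
    intro y hy y' hy' h
    have hd := hdist y y' (hF y (Finset.mem_coe.1 hy)).1 (hF y' (Finset.mem_coe.1 hy')).1
    rw [h, sub_self, norm_zero, mul_zero] at hd
    exact dist_eq_zero.1 hd
  have hcard : (F.image ζ).card = 6 := by rw [Finset.card_image_of_injOn hinj, hF6]
  -- a first vertex and its rotations by `ω`
  obtain ⟨y₁, hy₁⟩ : F.Nonempty := by rw [← Finset.card_pos, hF6]; norm_num
  set ω : ℂ := ⟨1 / 2, Real.sqrt 3 / 2⟩ with hω
  have hωω : ω * ω = ω - 1 := omega_mul_omega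
  have step : ∀ z ∈ F.image ζ, z * ω ∈ F.image ζ := fun z hz =>
    hexVertex_mul_mem _ hT1 hT2 hcard hz
  have h0 : ζ y₁ ∈ F.image ζ := Finset.mem_image_of_mem ζ hy₁
  have h1 := step _ h0
  have h2 := step _ h1
  have h3 := step _ h2
  have h4 := step _ h3
  have h5 := step _ h4
  -- the second vertex
  obtain ⟨v₁, hv₁, hv₁ζ⟩ := Finset.mem_image.1 h1
  have hy2 : y₁ 2 = 0 := (hF y₁ hy₁).1
  have hv2 : v₁ 2 = 0 := (hF v₁ hv₁).1
  -- pulling planar points back to `F`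
  have pull : ∀ z ∈ F.image ζ, ∀ w : EuclideanSpace ℝ (Fin 3), w 2 = 0 → z = ζ w →
      w ∈ (F : Set (EuclideanSpace ℝ (Fin 3))) := by
    intro z hz w hw2 hzw
    obtain ⟨y, hy, rfl⟩ := Finset.mem_image.1 hz
    have hd : dist y w = 0 := by
      rw [hdist y w (hF y hy).1 hw2, hzw, sub_self, norm_zero, mul_zero]
    rw [dist_eq_zero] at hd
    rw [← hd]
    exact hy
  have hζneg : ∀ w : EuclideanSpace ℝ (Fin 3), ζ (-w) = -ζ w := fun w => by
    apply Complex.ext <;> simp [hζ] <;> ring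
  have hζsub : ∀ w w' : EuclideanSpace ℝ (Fin 3), ζ (w - w') = ζ w - ζ w' := fun w w' => by
    apply Complex.ext <;> simp [hζ] <;> ring
  have e2 : ζ y₁ * ω * ω = ζ (v₁ - y₁) := by
    rw [hζsub]; linear_combination (ζ y₁) * hωω - hv₁ζ
  have e3 : ζ y₁ * ω * ω * ω = ζ (-y₁) := by
    rw [hζneg]; linear_combination (ζ y₁ * ω + ζ y₁) * hωω
  have e4 : ζ y₁ * ω * ω * ω * ω = ζ (-v₁) := by
    rw [hζneg]; linear_combination (ζ y₁ * ω * ω + ζ y₁ * ω) * hωω + hv₁ζ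
  have e5 : ζ y₁ * ω * ω * ω * ω * ω = ζ (y₁ - v₁) := by
    rw [hζsub]; linear_combination (ζ y₁ * ω * ω * ω + ζ y₁ * ω * ω - ζ y₁) * hωω + hv₁ζ
  have m2 : v₁ - y₁ ∈ (F : Set (EuclideanSpace ℝ (Fin 3))) := pull _ h2 _ (by simp [hy2, hv2]) e2
  have m3 : -y₁ ∈ (F : Set (EuclideanSpace ℝ (Fin 3))) := pull _ h3 _ (by simp [hy2]) e3
  have m4 : -v₁ ∈ (F : Set (EuclideanSpace ℝ (Fin 3))) := pull _ h4 _ (by simp [hv2]) e4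
  have m5 : y₁ - v₁ ∈ (F : Set (EuclideanSpace ℝ (Fin 3))) := pull _ h5 _ (by simp [hy2, hv2]) e5
  -- the angle between the first two vertices
  have hinner : inner ℝ y₁ v₁ = (2 : ℝ) ^ 2 / 2 := by
    have hre := congrArg Complex.re hv₁ζ
    have him := congrArg Complex.im hv₁ζ
    simp only [hζ, hω, Complex.mul_re, Complex.mul_im] at hre him
    have h4 : y₁ 0 ^ 2 + y₁ 1 ^ 2 = 4 := by
      have h := norm_sq_fin3 y₁
      rw [(hF y₁ hy₁).2, hy2] at h
      nlinarith
    rw [inner_fin3, hy2, hv2]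
    linear_combination (2 * y₁ 0) * hre + (2 * y₁ 1) * him + (1 / 2 : ℝ) * h4
  -- the frame
  obtain ⟨A, hA⟩ := exists_linearIsometry_frame (a := 2) two_pos hy2 hv2 (hF y₁ hy₁).2
    (hF v₁ hv₁).2 hinner
  have hs3 : Real.sqrt 3 ≠ 0 := (Real.sqrt_pos.2 (by norm_num : (0 : ℝ) < 3)).ne'
  have hAu : A (triangularVec₁ 2) = y₁ := by
    rw [hA]
    simp only [frameU_apply_zero, frameU_apply_one, frameU_apply_two, zero_smul, add_zero,
      smul_smul]
    norm_num
  have hAv : A (triangularVec₂ 2) = v₁ := by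
    rw [hA]
    simp only [frameV_apply_zero, frameV_apply_one, frameV_apply_two, zero_smul, add_zero,
      smul_smul, one_mul]
    rw [show Real.sqrt 3 * (2 * Real.sqrt 3)⁻¹ = 2⁻¹ by field_simp]
    module
  refine ⟨A.toLinearIsometryEquiv rfl, fun x hx => ?_⟩
  rw [LinearIsometry.toLinearIsometryEquiv_apply]
  simp only [hexagonSet, Set.mem_insert_iff, Set.mem_singleton_iff] at hx
  rcases hx with rfl | rfl | rfl | rfl | rfl | rfl
  · rw [hAu]; exact hy₁
  · rw [map_neg, hAu]; exact m3
  · rw [hAv]; exact hv₁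
  · rw [map_neg, hAv]; exact m4
  · rw [map_sub, hAu, hAv]; exact m5
  · rw [map_sub, hAu, hAv]; exact m2

/-- Twelve-point configurations are preserved by linear isometries of `ℝ³`. [folklore] -/
theorem isTwelveConfig_preimage {S : Set (EuclideanSpace ℝ (Fin 3))} (hS : IsTwelveConfig S)
    (M : EuclideanSpace ℝ (Fin 3) ≃ₗᵢ[ℝ] EuclideanSpace ℝ (Fin 3)) : IsTwelveConfig (M ⁻¹' S) where
  ncard_eq := by
    have h : (M ⁻¹' S) = M.symm '' S := by
      rw [LinearIsometryEquiv.image_eq_preimage_symm, LinearIsometryEquiv.symm_symm]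
    rw [h, Set.ncard_image_of_injective _ M.symm.injective, hS.ncard_eq]
  norm_eq := fun x hx => by rw [← M.norm_map]; exact hS.norm_eq _ hx
  two_le_dist := fun x hx y hy hxy => by
    rw [← M.dist_map]; exact hS.two_le_dist _ hx _ hy (fun h => hxy (M.injective h))

/-- **A twelve-point configuration with six points on a great circle is an FCC or HCP pattern.**
If `T ⊂ S²(2)` has twelve points with pairwise distances `≥ 2` and six of them are orthogonal to
a unit vector `n`, then `T` is arranged in the FCC pattern or in the HCP pattern (Hales, *Dense
Sphere Packings* §1.3: the six points are a regular hexagon, which forces a hole triple above and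
one below). [folklore] -/
theorem isArrangedIn_of_isTwelveConfig_of_hexagon : ∀ (T : Set (EuclideanSpace ℝ (Fin 3))) (n : EuclideanSpace ℝ (Fin 3)), ‖n‖ = 1 → Literature.Geometry.DiscreteGeometry.IsTwelveConfig T → ∀ (F : Finset (EuclideanSpace ℝ (Fin 3))), F.card = 6 → (∀ y ∈ F, y ∈ T ∧ inner ℝ y n = 0) → Literature.Geometry.DiscreteGeometry.IsArrangedIn T Literature.Geometry.DiscreteGeometry.fccKissingPattern ∨ Literature.Geometry.DiscreteGeometry.IsArrangedIn T Literature.Geometry.DiscreteGeometry.hcpKissingPattern := by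
  intro T n hn hT F hF6 hF
  -- rotate `n` to `e₃`
  obtain ⟨b, hb⟩ := exists_orthonormalBasis_third_eq (v := (2 : ℝ) • n)
    (by rw [norm_smul, hn]; norm_num)
  rw [smul_smul, show (1 / 2 * 2 : ℝ) = 1 by norm_num, one_smul] at hb
  set R : EuclideanSpace ℝ (Fin 3) ≃ₗᵢ[ℝ] EuclideanSpace ℝ (Fin 3) := b.repr with hR
  have hR2 : ∀ x, (R x) 2 = inner ℝ n x := fun x => by
    rw [hR, OrthonormalBasis.repr_apply_apply, hb]
  set T₁ : Set (EuclideanSpace ℝ (Fin 3)) := R.symm ⁻¹' T with hT₁def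
  have hT₁ : IsTwelveConfig T₁ := isTwelveConfig_preimage hT R.symm
  have hF₁6 : (F.image R).card = 6 := by rw [Finset.card_image_of_injective _ R.injective, hF6]
  have hF₁T : ∀ y ∈ F.image R, y ∈ T₁ := by
    intro y hy
    obtain ⟨x, hx, rfl⟩ := Finset.mem_image.1 hy
    show R.symm (R x) ∈ T
    rw [R.symm_apply_apply]
    exact (hF x hx).1
  have hF₁ : ∀ y ∈ F.image R, y 2 = 0 ∧ ‖y‖ = 2 := by
    intro y hy
    obtain ⟨x, hx, rfl⟩ := Finset.mem_image.1 hy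
    exact ⟨by rw [hR2, real_inner_comm, (hF x hx).2], by rw [R.norm_map]; exact hT.norm_eq x (hF x hx).1⟩
  have hsep : ∀ y ∈ F.image R, ∀ y' ∈ F.image R, y ≠ y' → 2 ≤ dist y y' :=
    fun y hy y' hy' hne => hT₁.two_le_dist y (hF₁T y hy) y' (hF₁T y' hy') hne
  -- move the hexagon onto the standard one
  obtain ⟨L, hL⟩ := exists_frame_of_planar_hexagon (F.image R) hF₁6 hF₁ hsep
  set T₂ : Set (EuclideanSpace ℝ (Fin 3)) := L ⁻¹' T₁ with hT₂def
  have hT₂ : IsTwelveConfig T₂ := isTwelveConfig_preimage hT₁ L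
  have hhex : hexagonSet ⊆ T₂ := fun x hx => hF₁T _ (hL x hx)
  obtain ⟨σ, σ', hσ, hσ', hS⟩ := hT₂.eq_layerShell hhex
  -- moving back
  have hback : ∀ P, IsArrangedIn T₂ P → IsArrangedIn T P := by
    intro P hP
    have e1 : L.symm ⁻¹' T₂ = T₁ := by
      ext y; simp [hT₂def]
    have e2 : R ⁻¹' T₁ = T := by
      ext y; simp [hT₁def]
    have h1 := hP.preimage L.symm
    rw [e1] at h1
    have h2 := h1.preimage R
    rwa [e2] at h2
  by_cases hcase : σ' = σ
  · subst hcase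
    refine Or.inr (hback _ ?_)
    rw [hS]
    exact isArrangedIn_layerShell_hcp' hσ
  · have hneg : σ' = -σ := by
      rcases hσ with rfl | rfl <;> rcases hσ' with rfl | rfl <;> first | exact absurd rfl hcase | norm_num
    refine Or.inl (hback _ ?_)
    rw [hS, hneg]
    exact isArrangedIn_layerShell_fcc' hσ

/-- **The scaled closed unit shell of a one-length local frame is a twelve-point configuration
through a hexagon.** At a point `p ∈ X` whose closed unit shell is exactly `H ∪ U ∪ D` (six points
at height `0`, three at height `c 1 > 0`, three at height `c (−1) < 0` along `n`, all at distance
`d ∈ (0, 1]` from `p`) and whose shell points see every other point of `X` closer than `1` at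
distance exactly `d`, the recentred shell scaled by `2/d` has twelve points of norm `2`, pairwise
`≥ 2` apart, six of which (the scaled hexagon) are orthogonal to `n`. [folklore] -/
theorem shell_isTwelveConfig (X : Set (EuclideanSpace ℝ (Fin 3))) (d : ℝ)
    (p n : EuclideanSpace ℝ (Fin 3)) (c : ℤ → ℝ) (H U D : Finset (EuclideanSpace ℝ (Fin 3)))
    (hd0 : 0 < d) (hd1 : d ≤ 1) (hc0 : c 0 = 0) (hgap : ∀ k : ℤ, c k + 19 / 25 ≤ c (k + 1))
    (hH6 : H.card = 6) (hU3 : U.card = 3) (hD3 : D.card = 3)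
    (hH : ∀ q ∈ H, q ∈ X ∧ inner ℝ (q - p) n = 0 ∧ dist p q = d)
    (hU : ∀ q ∈ U, q ∈ X ∧ inner ℝ (q - p) n = c 1 ∧ dist p q = d)
    (hD : ∀ q ∈ D, q ∈ X ∧ inner ℝ (q - p) n = c (-1) ∧ dist p q = d)
    (hclosed : ∀ q ∈ X, q ≠ p → dist q p ≤ 1 → q ∈ H ∨ q ∈ U ∨ q ∈ D)
    (hsharp : ∀ q ∈ X, q ≠ p → dist q p ≤ 1 → ∀ r ∈ X, r ≠ q → dist q r < 1 → dist q r = d) :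
    IsTwelveConfig {y : EuclideanSpace ℝ (Fin 3) | p + (d / 2) • y ∈ X ∧ ‖y‖ = 2} ∧
      ∃ F : Finset (EuclideanSpace ℝ (Fin 3)), F.card = 6 ∧
        ∀ y ∈ F, y ∈ {y : EuclideanSpace ℝ (Fin 3) | p + (d / 2) • y ∈ X ∧ ‖y‖ = 2} ∧
          inner ℝ y n = 0 := by
  classical
  set T : Set (EuclideanSpace ℝ (Fin 3)) := {y | p + (d / 2) • y ∈ X ∧ ‖y‖ = 2} with hTdef
  -- heights of the three pieces
  have hc1 : 19 / 25 ≤ c 1 := by have h := hgap 0; rw [hc0, zero_add, zero_add] at h; exact h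
  have hcm1 : c (-1) ≤ -(19 / 25) := by
    have h := hgap (-1); rw [show (-1 : ℤ) + 1 = 0 by norm_num, hc0] at h; linarith
  -- the scaling map and its basic properties
  have hdd : d / 2 * (2 / d) = 1 := by field_simp
  have hdd' : 2 / d * (d / 2) = 1 := by field_simp
  set φ : EuclideanSpace ℝ (Fin 3) → EuclideanSpace ℝ (Fin 3) := fun q => (2 / d) • (q - p) with hφ
  have hφinv : ∀ q, p + (d / 2) • φ q = q := fun q => by
    simp only [hφ, smul_smul, hdd, one_smul, add_sub_cancel]
  have hφinj : Function.Injective φ := fun q q' h => by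
    have := congrArg (fun y => p + (d / 2) • y) h
    simpa only [hφinv] using this
  have hφnorm : ∀ q, dist p q = d → ‖φ q‖ = 2 := fun q hq => by
    rw [hφ]
    dsimp only
    rw [norm_smul, Real.norm_of_nonneg (by positivity), ← dist_eq_norm, dist_comm, hq]
    field_simp
  have hφinner : ∀ q, inner ℝ (φ q) n = 2 / d * inner ℝ (q - p) n := fun q => by
    rw [hφ]
    dsimp only
    rw [real_inner_smul_left]
  -- points of `T` come from the shell
  have hTq : ∀ y ∈ T, p + (d / 2) • y ∈ X ∧ p + (d / 2) • y ≠ p ∧ dist (p + (d / 2) • y) p = d := by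
    intro y hy
    have hn2 : ‖(d / 2) • y‖ = d := by
      rw [norm_smul, Real.norm_of_nonneg (by positivity), hy.2]; ring
    refine ⟨hy.1, fun h => ?_, by rw [dist_eq_norm, add_sub_cancel_left, hn2]⟩
    have h0 : (d / 2) • y = 0 := by simpa using h
    rw [h0, norm_zero] at hn2
    exact hd0.ne' hn2.symm
  have hTsub : ∀ y ∈ T, ∃ q ∈ H ∪ U ∪ D, φ q = y := by
    intro y hy
    obtain ⟨hqX, hqp, hqd⟩ := hTq y hy
    refine ⟨p + (d / 2) • y, ?_, ?_⟩
    · rcases hclosed _ hqX hqp (hqd.le.trans hd1) with h | h | h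
      · exact Finset.mem_union_left _ (Finset.mem_union_left _ h)
      · exact Finset.mem_union_left _ (Finset.mem_union_right _ h)
      · exact Finset.mem_union_right _ h
    · simp only [hφ, add_sub_cancel_left, smul_smul, hdd', one_smul]
  have hshell : ∀ q ∈ H ∪ U ∪ D, q ∈ X ∧ dist p q = d := by
    intro q hq
    rcases Finset.mem_union.1 hq with hq | hq
    · rcases Finset.mem_union.1 hq with hq | hq
      · exact ⟨(hH q hq).1, (hH q hq).2.2⟩
      · exact ⟨(hU q hq).1, (hU q hq).2.2⟩
    · exact ⟨(hD q hq).1, (hD q hq).2.2⟩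
  have hφmem : ∀ q ∈ H ∪ U ∪ D, φ q ∈ T := fun q hq =>
    ⟨by rw [hφinv]; exact (hshell q hq).1, hφnorm q (hshell q hq).2⟩
  have hTeq : T = ((H ∪ U ∪ D).image φ : Finset (EuclideanSpace ℝ (Fin 3))) := by
    ext y
    simp only [Finset.coe_image, Set.mem_image, Finset.mem_coe]
    exact ⟨fun hy => hTsub y hy, fun ⟨q, hq, hqy⟩ => hqy ▸ hφmem q hq⟩
  -- the three pieces are disjoint: twelve points
  have hHU : Disjoint H U := by
    rw [Finset.disjoint_left]
    intro q hqH hqU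
    have h1 := (hH q hqH).2.1; have h2 := (hU q hqU).2.1
    linarith
  have hHUD : Disjoint (H ∪ U) D := by
    rw [Finset.disjoint_left]
    intro q hq hqD
    have h2 := (hD q hqD).2.1
    rcases Finset.mem_union.1 hq with hq | hq
    · have h1 := (hH q hq).2.1; linarith
    · have h1 := (hU q hq).2.1; linarith
  have h12 : (H ∪ U ∪ D).card = 12 := by
    rw [Finset.card_union_of_disjoint hHUD, Finset.card_union_of_disjoint hHU, hH6, hU3, hD3]
  refine ⟨⟨?_, fun y hy => hy.2, ?_⟩, ?_⟩
  · rw [hTeq, Set.ncard_coe_finset, Finset.card_image_of_injective _ hφinj, h12]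
  · -- pairwise distances
    intro y hy y' hy' hne
    obtain ⟨hqX, hqp, hqd⟩ := hTq y hy
    obtain ⟨hq'X, -, -⟩ := hTq y' hy'
    have hqq' : p + (d / 2) • y ≠ p + (d / 2) • y' := fun h => hne <| by
      have h' := add_left_cancel h
      exact smul_right_injective _ (by positivity : d / 2 ≠ 0) h'
    have hdist : dist (p + (d / 2) • y) (p + (d / 2) • y') = d / 2 * dist y y' := by
      rw [dist_add_left, dist_smul₀, Real.norm_of_nonneg (by positivity)]
    by_cases hlt : dist (p + (d / 2) • y) (p + (d / 2) • y') < 1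
    · have h := hsharp _ hqX hqp (hqd.le.trans hd1) _ hq'X hqq'.symm hlt
      rw [hdist] at h
      have : dist y y' = 2 := by field_simp at h; linarith
      rw [this]
    · rw [not_lt, hdist] at hlt
      nlinarith [dist_nonneg (x := y) (y := y')]
  · -- the hexagon
    refine ⟨H.image φ, by rw [Finset.card_image_of_injective _ hφinj, hH6], fun y hy => ?_⟩
    obtain ⟨q, hq, rfl⟩ := Finset.mem_image.1 hy
    refine ⟨hφmem q (Finset.mem_union_left _ (Finset.mem_union_left _ hq)), ?_⟩
    rw [hφinner, (hH q hq).2.1, mul_zero]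

end Summit.AtomisticToContinuum.Crystallization.Theorems.SquareWellLayerCake.StackingFaultSparsity.LocalFrames.OneLength

end
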